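import Mathlib
import Literature.NumberTheory.Transcendental.ZagierDilogarithmConjecture
import Literature.NumberTheory.Transcendental.BlochWignerDilogarithm
import Literature.NumberTheory.Transcendental.BlochWignerDilogarithmProofs
import Literature.NumberTheory.Transcendental.BlochWignerFiveTerm
import Summits.KontsevichZagierPeriods.KontsevichZagierPeriods.Theorems.HyperbolicBlochZagierDilogarithmConjectureDehnRigidity
import Summits.KontsevichZagierPeriods.KontsevichZagierPeriods.Theorems.HyperbolicBlochZagierDilogarithmConjectureOctPrelims
import HarnessLib

/-!
# `ZagierDilogarithmConjecture` (stmt-KontsevichZagierPeriods-10550) — line `kummer-clausen-linearisation`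
(reshape c5, "the cyclotomic tower and the abelian sector"), stub `stub_milnorEight_iff_irrational`

**Milnor's conjecture at level 8 is ONE irrationality statement: `G / Cl₂(π/4) ∉ ℚ`.** Let
`ζ = ζ₈ = e^{2πi/8}`, let `D` be the Bloch–Wigner dilogarithm (`blochWignerDilog`) and `G = D(i)`
(Catalan's constant). The line's `ℤ`-form of Milnor's conjecture at level `N` (Milnor 1982, Appendix)
asks that every `m : ℤ/N → ℤ` supported on the residues `c` that are units with `0 < c < N/2` and
satisfying `Σ_c m_c D(ζ_N^c) = 0` vanishes identically. At level `8` the admissible residues are exactly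
`{1, 3}` (`2` is not a unit mod `8`), so Milnor_8 is the `ℤ`-independence of `A = D(ζ)` and `B = D(ζ³)`.

**The value identity `2(A − B) = D(i)`.** The duplication relation `D(z²) = 2D(z) + 2D(−z)`
(`blochWignerDilog_sq`, the case `N = 2` of the distribution relations of `D`) at `z = ζ` reads
`D(i) = 2D(ζ) + 2D(−ζ)` (`ζ² = i`), and `−ζ = ζ⁵ = conj(ζ³)` (`conj ζ = ζ⁷`, `ζ⁴ = −1`), so
`D(−ζ) = −D(ζ³)` (`D(z̄) = −D(z)`): `D(i) = 2A − 2B`. Hence `span_ℤ{A, B} = span_ℤ{A, D(i)/2}` and, as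
`A > 0` (`D > 0` on `ℍ⁺`), Milnor_8 ⇔ [`a·A + b·B = 0 ⇒ a = b = 0`] ⇔ [`D(i)/A ∉ ℚ`].

Proof. `⇒`: if `D(i)/A = a/b` with `b ≠ 0`, then `b·D(i) = a·A`, i.e. `(a − 2b)·A + 2b·B = 0`, an
admissible relation (`m₁ = a − 2b`, `m₃ = 2b`), so Milnor forces `2b = 0`, absurd. `⇐`: an admissible
`m` is supported on `{1, 3}` and its relation reads `m₁ A + m₃ B = 0`, i.e. `m₃ D(i) = 2(m₁ + m₃) A`; if
`m₃ ≠ 0` then `D(i)/A = 2(m₁ + m₃)/m₃ ∈ ℚ`, contradiction, so `m₃ = 0`, and then `m₁ A = 0` with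
`A > 0` gives `m₁ = 0`. Sorry-free; axioms ⊆ {propext, Classical.choice, Quot.sound}.

## References

* J. Milnor, *Hyperbolic geometry: the first 150 years*, Bull. AMS 6 (1982), Appendix (the conjecture
  on the values `Л(πc/N)`). [Milnor1982]
* D. Zagier, *The dilogarithm function* (2007), Ch. I §2 (duplication / distribution relations).
  [Zagier2007Dilogarithm]
-/

noncomputable section

open scoped BigOperators ComplexConjugate
open Literature.NumberTheory.Transcendental

namespace Summit.KontsevichZagierPeriods.HyperbolicBloch.ZagierDilogarithmCyclotomic

open Summit.KontsevichZagierPeriods.HyperbolicBloch.ZagierDilogarithm (blochWignerDilog_pos)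
open Summit.KontsevichZagierPeriods.HyperbolicBloch.ZagierDilogarithmCertificate

namespace MilnorEight

/-- `ζ₈² = i` for `ζ₈ = exp(2πi/8)` (`exp(πi/2) = i`). [folklore] -/
theorem zeta_sq : Complex.exp (2 * Real.pi * Complex.I / 8) ^ 2 = Complex.I := by
  rw [← Complex.exp_nat_mul,
    show ((2 : ℕ) : ℂ) * (2 * Real.pi * Complex.I / 8) = Real.pi / 2 * Complex.I by push_cast; ring,
    Complex.exp_pi_div_two_mul_I]

/-- `conj(ζ₈³) = −ζ₈` for `ζ₈ = exp(2πi/8)`: `conj(ζ₈³) = ζ₈²¹ = (ζ₈⁴)⁵·ζ₈ = −ζ₈`. [folklore] -/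
theorem conj_zeta_pow_three :
    conj (Complex.exp (2 * Real.pi * Complex.I / 8) ^ 3) =
      -Complex.exp (2 * Real.pi * Complex.I / 8) := by
  rw [map_pow, oct_prelims_conj, ← pow_mul, show 7 * 3 = 4 * 5 + 1 by norm_num, pow_succ, pow_mul,
    oct_prelims_pow_four]
  ring

/-- **The value identity `D(i) = 2D(ζ₈) − 2D(ζ₈³)`** (`G = 2(Cl₂(π/4) − Cl₂(3π/4))/…` in Clausen
form): the duplication relation `D(z²) = 2D(z) + 2D(−z)` at `z = ζ₈` together with `ζ₈² = i`,
`−ζ₈ = conj(ζ₈³)` and `D(z̄) = −D(z)`. [cite: Zagier2007Dilogarithm, Ch. I §2] -/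
theorem blochWignerDilog_I_eq :
    blochWignerDilog Complex.I =
      2 * blochWignerDilog (Complex.exp (2 * Real.pi * Complex.I / 8)) -
        2 * blochWignerDilog (Complex.exp (2 * Real.pi * Complex.I / 8) ^ 3) := by
  conv_lhs => rw [← zeta_sq]
  rw [blochWignerDilog_sq, ← conj_zeta_pow_three, blochWignerDilog_conj']
  ring

/-- `2` is not a unit of `ℤ/8`. [folklore] -/
theorem not_isUnit_two : ¬IsUnit (2 : ZMod 8) := by
  intro h
  obtain ⟨u, hu⟩ := h.exists_right_inv
  exact absurd hu (by revert u; decide)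

/-- The residues `c mod 8` that are units with `0 < c < 8/2` are `1` and `3`. [folklore] -/
theorem eq_one_or_eq_three {c : ZMod 8} (hu : IsUnit c) (h0 : 0 < c.val) (h2 : 2 * c.val < 8) :
    c = 1 ∨ c = 3 := by
  have h1 : (1 : ZMod 8).val = 1 := rfl
  have h2' : (2 : ZMod 8).val = 2 := rfl
  have h3 : (3 : ZMod 8).val = 3 := rfl
  rcases (show c.val = 1 ∨ c.val = 2 ∨ c.val = 3 by omega) with hv | hv | hv
  · exact Or.inl (ZMod.val_injective 8 (hv.trans h1.symm))
  · exact absurd (ZMod.val_injective 8 (hv.trans h2'.symm) ▸ hu) not_isUnit_two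
  · exact Or.inr (ZMod.val_injective 8 (hv.trans h3.symm))

/-- A sum `Σ_{c mod 8} m_c D(ζ₈^c)` with `m` supported on `{1, 3}` is `m₁ D(ζ₈) + m₃ D(ζ₈³)`.
[folklore] -/
theorem sum_eq_of_support (m : ZMod 8 → ℤ) (hm : ∀ c, m c ≠ 0 → c = 1 ∨ c = 3) :
    ∑ c : ZMod 8, (m c : ℝ) *
        blochWignerDilog (Complex.exp (2 * Real.pi * Complex.I / 8) ^ c.val) =
      (m 1 : ℝ) * blochWignerDilog (Complex.exp (2 * Real.pi * Complex.I / 8)) +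
        (m 3 : ℝ) * blochWignerDilog (Complex.exp (2 * Real.pi * Complex.I / 8) ^ 3) := by
  rw [Fintype.sum_eq_add (1 : ZMod 8) 3 (by decide)]
  · have h1 : (1 : ZMod 8).val = 1 := rfl
    have h3 : (3 : ZMod 8).val = 3 := rfl
    rw [h1, h3, pow_one]
  · rintro c ⟨hc1, hc3⟩
    have h0 : m c = 0 := by
      by_contra h
      rcases hm c h with rfl | rfl
      · exact hc1 rfl
      · exact hc3 rfl
    rw [h0, Int.cast_zero, zero_mul]

end MilnorEight

/-- **Milnor's conjecture at level 8 is ONE irrationality statement** (stub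
`stub_milnorEight_iff_irrational` of line `kummer-clausen-linearisation`). `(ℤ/8)ˣ ∩ (0, 4) = {1, 3}`,
`D > 0` on `ℍ⁺`, and the duplication relation gives `2(D(ζ₈) − D(ζ₈³)) = D(i) = G`, so Milnor_8 (the
`ℤ`-independence of `D(ζ₈), D(ζ₈³)`) says exactly that `D(i)/D(ζ₈) = G/Cl₂(π/4)` is irrational.
[cite: Milnor1982, Appendix] -/
theorem stub_milnorEight_iff_irrational :
    (∀ m : ZMod 8 → ℤ, (∀ c, m c ≠ 0 → IsUnit c ∧ 0 < c.val ∧ 2 * c.val < 8) →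
          ∑ c : ZMod 8, (m c : ℝ) *
              blochWignerDilog (Complex.exp (2 * Real.pi * Complex.I / 8) ^ c.val) = 0 →
            ∀ c, m c = 0) ↔
      Irrational (blochWignerDilog Complex.I / blochWignerDilog (Complex.exp (2 * Real.pi * Complex.I / 8))) := by
  have hD1 : 0 < blochWignerDilog (Complex.exp (2 * Real.pi * Complex.I / 8)) :=
    blochWignerDilog_pos oct_prelims_im_one_pos
  have hI := MilnorEight.blochWignerDilog_I_eq
  constructor
  · intro hM
    rw [irrational_iff_ne_rational]
    intro a b hb hab
    rw [div_eq_div_iff hD1.ne' (Int.cast_ne_zero.2 hb)] at hab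
    obtain ⟨m, hm1, hm3, hm0⟩ : ∃ m : ZMod 8 → ℤ, m 1 = a - 2 * b ∧ m 3 = 2 * b ∧
        ∀ c, c ≠ 1 → c ≠ 3 → m c = 0 := by
      refine ⟨fun c => if c = 1 then a - 2 * b else if c = 3 then 2 * b else 0, ?_, ?_, ?_⟩
      · simp
      · have h31 : (3 : ZMod 8) ≠ 1 := by decide
        simp [h31]
      · intro c h1 h3
        simp [h1, h3]
    have hsupp' : ∀ c, m c ≠ 0 → c = 1 ∨ c = 3 := by
      intro c hc
      by_contra h
      push Not at h
      exact hc (hm0 c h.1 h.2)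
    have hsupp : ∀ c, m c ≠ 0 → IsUnit c ∧ 0 < c.val ∧ 2 * c.val < 8 := by
      intro c hc
      rcases hsupp' c hc with rfl | rfl
      · exact ⟨isUnit_one, by decide⟩
      · exact ⟨IsUnit.of_mul_eq_one (3 : ZMod 8) (by decide), by decide⟩
    have hsum : ∑ c : ZMod 8, (m c : ℝ) *
        blochWignerDilog (Complex.exp (2 * Real.pi * Complex.I / 8) ^ c.val) = 0 := by
      rw [MilnorEight.sum_eq_of_support m hsupp', hm1, hm3]
      push_cast
      linear_combination (b : ℝ) * hI - hab
    have h3 := hM m hsupp hsum 3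
    rw [hm3] at h3
    exact hb (by omega)
  · intro hx m hsupp hsum
    have hsupp' : ∀ c, m c ≠ 0 → c = 1 ∨ c = 3 := fun c hc =>
      MilnorEight.eq_one_or_eq_three (hsupp c hc).1 (hsupp c hc).2.1 (hsupp c hc).2.2
    rw [MilnorEight.sum_eq_of_support m hsupp'] at hsum
    have hm3 : m 3 = 0 := by
      by_contra h3
      refine (irrational_iff_ne_rational _).1 hx (2 * (m 1 + m 3)) (m 3) h3 ?_
      rw [div_eq_div_iff hD1.ne' (Int.cast_ne_zero.2 h3)]
      push_cast
      linear_combination (m 3 : ℝ) * hI - 2 * hsum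
    have hm1 : m 1 = 0 := by
      rw [hm3, Int.cast_zero, zero_mul, add_zero] at hsum
      rcases mul_eq_zero.1 hsum with h | h
      · exact_mod_cast h
      · exact absurd h hD1.ne'
    intro c
    by_contra hc
    rcases hsupp' c hc with rfl | rfl
    · exact hc hm1
    · exact hc hm3

end Summit.KontsevichZagierPeriods.HyperbolicBloch.ZagierDilogarithmCyclotomic

end
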